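import Literature.NumberTheory.EllipticCurves.CyclicIsogenyDegreeTwenty
import Literature.NumberTheory.EllipticCurves.IsogenyTwoPowerQuotientProofs
import Literature.NumberTheory.EllipticCurves.KenkuMinimalLevelsKleinFrickeFiveSeven
import Literature.NumberTheory.EllipticCurves.KubertTwoTenProofs
import Mathlib.NumberTheory.Real.Irrational
import HarnessLib

/-!
# Kenku 1982, Thm. 1 (level 20): no cyclic `ℚ`-isogeny of degree `20` — Literature-side DISCHARGE of
# `isogeny_isCyclic_degree_ne_twenty`

RE-HOMED into Literature (seat bsd-rank2-lit GEN 14, 2026-08-27; HIDDEN-DISCHARGES sweep,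
run/shared/lean/pub/bsd-rank2/lit/HIDDEN-DISCHARGES.md): verbatim concatenation of the three Summits files
`Summits/ABC/ABC/Theorems/IsogenyGlueCongruenceMazurKenkuBound{StubTwoVertex,LevelTwentyDiophantine,LevelTwenty}.lean`
(cell ABC, crux `MazurKenkuBound` stmt-ABC-15125, line `radius-lite` — the authors of the mathematics), which import only
Literature; namespace `Summit.ABC.ABC.Theorems` ↦ `Literature.NumberTheory.EllipticCurves.Kenku1982`, route-stub names
`stub_twoVertex` / `stub_levelTwentyNoPoint` / `stub_levelTwenty` ↦ `kenku_twoVertex` / `kenku_levelTwentyNoPoint` /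
`kenku_levelTwenty`; the discharge `Literature.NumberTheory.EllipticCurves.isogeny_isCyclic_degree_ne_twenty_holds` is
declared next to the fact (`CyclicIsogenyDegreeTwenty.lean`). Theorems only, no definitions; cite tags added per decl.
The three original module headers follow as section comments.
-/


noncomputable section

/-!
# Crux `MazurKenkuBound` (stmt-ABC-15125), line `Sketch` — stub `kenku_twoVertex`:
# the vertex criterion of the `2`-chain

On an elliptic curve `V : y² = x³ + ax² + bx` over `ℚ` (two-torsion normal form, `T = (0, 0)`
its rational `2`-torsion point), a `Γ_ℚ`-stable cyclic subgroup `C ⊆ V(ℚ̄)` of order `2ᵏ`,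
`k ≥ 2`, whose element of order `2` is `T` forces `b` to be a square in `ℚ`:

1. a generator `g` of `C` has order `2ᵏ`, so `Q := 2ᵏ⁻² g ∈ C` has `2Q ≠ O`, `4Q = O`,
   whence `2Q = T` (the hypothesis on the `2`-torsion of `C`); `Q ∉ {O, T}`, so `Q = (x, y)` with
   `x ≠ 0`, `y ≠ -y`, and the duplication formula `x(2Q) · (2y)² = (x² - b)²` (Silverman,
   *AEC*, III.2.3 (d); the tree's `addX_self_mul`) with `x(2Q) = x(T) = 0` gives `x² = b`;
2. for `σ ∈ Γ_ℚ`, `σT = T` and `σQ ∈ C` with `2(σQ - Q) = O`, so `σQ - Q ∈ {O, T}`: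
   `σQ = Q` or `σQ = T + Q = (b/x, -by/x²) = (x, -y)`; in both cases `σx = x(σQ) = x`;
3. `ℚ̄^{Γ_ℚ} = ℚ` (Mathlib's `InfiniteGalois.mem_range_algebraMap_iff_fixed`, `ℚ` perfect),
   so `x = d ∈ ℚ` and `b = d²`.

The argument is written for any perfect base field (`twoVertex_exists_sq`) and specialised to
the literal equation `⟨0, a, 0, b, 0⟩` over `ℚ` in `kenku_twoVertex`.

## References

* [SilvermanAEC2009] J. H. Silverman, *The Arithmetic of Elliptic Curves*, 2nd ed., GTM 106
  (2009), III.2.3 (d) (duplication formula), III.4 Example 4.5, X.4.9; I.§1 and VIII.§1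
  (Galois descent).
-/



open scoped Classical
open WeierstrassCurve
open Literature.NumberTheory.EllipticCurves

namespace Literature.NumberTheory.EllipticCurves.Kenku1982

universe u

/-- On `y² = x³ + ax² + bx` (two-torsion normal form, elliptic), an affine point `P` with
`P + P = T = (0, 0)` is `(x, y)` with `x ≠ 0` and `x² = b`: `P ∉ {O, T}` and `y ≠ -y`, and
the duplication formula `x(2P) · (2y)² = (x² - b)²` with `x(2P) = 0`.
[cite: SilvermanAEC2009, III.2.3 (d)] -/
private theorem exists_eq_some_sq_eq_of_add_self_eq {F : Type*} [Field F]
    (W : WeierstrassCurve F) [W.IsTwoTorsionNF] [W.IsElliptic] {P : W.toAffine.Point}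
    (hP : P + P = W.twoTorsionPoint) :
    ∃ (x y : F) (h : W.toAffine.Nonsingular x y),
      P = .some x y h ∧ x ≠ 0 ∧ x ^ 2 = W.a₄ := by
  rcases P with _ | ⟨x, y, h⟩
  · rw [← Affine.Point.zero_def, add_zero] at hP
    exact absurd hP.symm (Affine.Point.some_ne_zero _)
  · have hy : y ≠ W.toAffine.negY x y := by
      intro hy
      rw [Affine.Point.add_self_of_Y_eq hy] at hP
      exact Affine.Point.some_ne_zero _ hP.symm
    have key := addX_self_mul W h hy
    rw [Affine.Point.add_self_of_Y_ne hy, twoTorsionPoint, Affine.Point.some.injEq] at hP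
    rw [hP.1, zero_mul] at key
    have hxb : x ^ 2 = W.a₄ := sub_eq_zero.mp ((pow_eq_zero_iff two_ne_zero).mp key.symm)
    refine ⟨x, y, h, rfl, ?_, hxb⟩
    rintro rfl
    apply a₄_ne_zero W
    rw [← hxb]
    ring

/-- `T + (x, y) = (b/x, -by/x²)` has first coordinate `x` when `x² = b`. [folklore]
[cite: Kenku1982, Thm. 1 and its proof (level 20)] -/
private theorem exists_twoTorsionPoint_add_some_eq {F : Type*} [Field F]
    (W : WeierstrassCurve F) [W.IsTwoTorsionNF] [W.IsElliptic] {x y : F}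
    (h : W.toAffine.Nonsingular x y) (hx : x ≠ 0) (hxb : x ^ 2 = W.a₄) :
    ∃ (y' : F) (h' : W.toAffine.Nonsingular x y'),
      W.twoTorsionPoint + .some x y h = .some x y' h' := by
  obtain ⟨h', e⟩ := twoTorsionPoint_add_some W h hx
  have hX : W.a₄ / x = x := by rw [div_eq_iff hx, ← hxb, sq]
  obtain ⟨h'', e''⟩ := some_eq_some_of_eq h' hX rfl
  exact ⟨_, h'', e.trans e''⟩

/-- **The vertex criterion** (any perfect base field `K`): on an elliptic
`V : y² = x³ + ax² + bx` over `K`, a `Γ_K`-stable cyclic subgroup `C ⊆ V(K̄)` of order `2ᵏ`,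
`k ≥ 2`, whose element of order `2` is `T = (0, 0)` forces `b = d²` with `d ∈ K`: the point
`Q = 2ᵏ⁻²g` (`g` a generator)
has `2Q = T`, so `x(Q)² = b` (duplication formula), and `σQ - Q ∈ C ∩ V[2] = {O, T}` gives
`σQ ∈ {Q, T + Q}`, both with first coordinate `x(Q)`; hence `x(Q) ∈ K̄^{Γ_K} = K`.
[cite: SilvermanAEC2009, III.2.3 (d)] -/
theorem twoVertex_exists_sq {K : Type u} [Field K] [PerfectField K] (V : WeierstrassCurve K)
    [V.IsTwoTorsionNF] [V.IsElliptic] (C : AddSubgroup V.geomPoints) {k : ℕ} (hk : 2 ≤ k)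
    (hst : ∀ σ : Field.absoluteGaloisGroup K, ∀ P ∈ C, σ • P ∈ C) (hcyc : IsAddCyclic C)
    (hcard : Nat.card C = 2 ^ k)
    (h2 : ∀ P ∈ C, 2 • P = 0 → P ≠ 0 → P = V.geomTwoTorsionPoint) :
    ∃ d : K, V.a₄ = d ^ 2 := by
  -- a point `Q ∈ C` with `4Q = O`, `2Q ≠ O`
  obtain ⟨Q, hQC, h4Q, h2Q0⟩ : ∃ Q ∈ C, 2 • (2 • Q) = 0 ∧ 2 • Q ≠ 0 := by
    obtain ⟨g, hg⟩ := IsAddCyclic.exists_ofOrder_eq_natCard (α := C)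
    rw [hcard, ← AddSubgroup.addOrderOf_coe] at hg
    refine ⟨2 ^ (k - 2) • (g : V.geomPoints), C.nsmul_mem g.2 _, ?_, ?_⟩
    · have e : 2 * 2 * 2 ^ (k - 2) = 2 ^ k := by
        rw [mul_assoc, ← pow_succ', ← pow_succ', show k - 2 + 1 + 1 = k by omega]
      rw [smul_smul, smul_smul, e, ← hg]
      exact addOrderOf_nsmul_eq_zero _
    · intro h0
      rw [smul_smul, ← pow_succ'] at h0
      have hdvd := addOrderOf_dvd_of_nsmul_eq_zero h0
      rw [hg, Nat.pow_dvd_pow_iff_le_right Nat.one_lt_two] at hdvd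
      omega
  -- `2Q = T ∈ C`
  have hT : 2 • Q = V.geomTwoTorsionPoint := h2 _ (C.nsmul_mem hQC 2) h4Q h2Q0
  have hTC : V.geomTwoTorsionPoint ∈ C := hT ▸ C.nsmul_mem hQC 2
  -- coordinates of `Q`: `x ≠ 0`, `x² = b`
  obtain ⟨x, y, h, hQ, hx, hxb⟩ := exists_eq_some_sq_eq_of_add_self_eq
    (V.baseChange (AlgebraicClosure K)) (P := Q) (by rw [← two_nsmul]; exact hT)
  obtain ⟨y', h', e'⟩ :=
    exists_twoTorsionPoint_add_some_eq (V.baseChange (AlgebraicClosure K)) h hx hxb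
  have hTQ : V.geomTwoTorsionPoint + Q = (Affine.Point.some x y' h' : V.geomPoints) := by
    rw [hQ]
    exact e'
  -- `x` is fixed by `Γ_K`
  have hfix : ∀ σ : Field.absoluteGaloisGroup K,
      (show AlgebraicClosure K ≃ₐ[K] AlgebraicClosure K from σ) x = x := by
    intro σ
    -- `σT = T`
    have hσT : σ • V.geomTwoTorsionPoint = V.geomTwoTorsionPoint := by
      refine h2 _ (hst σ _ hTC) ?_ ?_
      · rw [smul_comm, ← hT, h4Q, smul_zero]
      · exact (smul_ne_zero_iff_ne σ).mpr (geomTwoTorsionPoint_ne_zero V)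
    -- `2(σQ - Q) = O`, so `σQ - Q ∈ {O, T}`
    have hD : 2 • (σ • Q - Q) = 0 := by rw [nsmul_sub, smul_comm, hT, hσT, sub_self]
    obtain ⟨h₁, e₁⟩ := smul_eq_some_of_eq' V σ hQ
    by_cases hD0 : σ • Q - Q = 0
    · rw [sub_eq_zero, e₁, hQ] at hD0
      exact (Affine.Point.some.inj hD0).1
    · have hDT := h2 _ (C.sub_mem (hst σ Q hQC) hQC) hD hD0
      rw [sub_eq_iff_eq_add, e₁, hTQ] at hDT
      exact (Affine.Point.some.inj hDT).1
  -- Galois descent: `x ∈ K`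
  haveI : IsGalois K (AlgebraicClosure K) := {}
  obtain ⟨d, hd⟩ := (InfiniteGalois.mem_range_algebraMap_iff_fixed x).mpr fun σ ↦ hfix σ
  refine ⟨d, (algebraMap K (AlgebraicClosure K)).injective ?_⟩
  rw [map_pow, hd, hxb]
  rfl

/-- STUB 9 (vertex criterion): on an elliptic `y² = x³ + ax² + bx` over `ℚ`, a `Γ_ℚ`-stable
cyclic subgroup of order `2ᵏ`, `k ≥ 2`, whose element of order `2` is `T = (0,0)` forces `b` to
be a square: a point `Q` of order `4` in it has `2Q = T`, so `x(Q)² = b` by the duplication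
formula (`addX_self_mul`), and `σQ ∈ {Q, Q + T}` for all `σ ∈ Γ_ℚ`, so `x(Q) ∈ ℚ`
(`twoVertex_exists_sq` on the literal equation). [cite: SilvermanAEC2009, III.2.3 (d)] -/
theorem kenku_twoVertex :
    ∀ (a b : ℚ) [(⟨0, a, 0, b, 0⟩ : WeierstrassCurve ℚ).IsElliptic]
      (C : AddSubgroup (⟨0, a, 0, b, 0⟩ : WeierstrassCurve ℚ).geomPoints) (k : ℕ), 2 ≤ k →
      (∀ σ : Field.absoluteGaloisGroup ℚ, ∀ P ∈ C, σ • P ∈ C) → IsAddCyclic C →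
      Nat.card C = 2 ^ k →
      (∀ P ∈ C, 2 • P = 0 → P ≠ 0 →
        P = (⟨0, a, 0, b, 0⟩ : WeierstrassCurve ℚ).geomTwoTorsionPoint) →
      ∃ d : ℚ, b = d ^ 2 := by
  intro a b _ C k hk hst hcyc hcard h2
  exact twoVertex_exists_sq (⟨0, a, 0, b, 0⟩ : WeierstrassCurve ℚ) C hk hst hcyc hcard h2

end Literature.NumberTheory.EllipticCurves.Kenku1982

/-!
# Crux `MazurKenkuBound` (stmt-ABC-15125), line `radius-lite` — Kenku's level `20`, step 2:
# the fibre product `X₀(4) ×_{X(1)} X₀(5)` has no rational point off the cusps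

THE DIOPHANTINE END of the modular-curve-free treatment of Kenku's level `20` (registered stub
`kenku_levelTwentyNoPoint`): there are no `s, t ∈ ℚ` with `t ≠ 0`, `s² ≠ 4` and
`256 t (s² − 3)³ = (s² − 4)(t² + 10t + 5)³` (equality of the `j`-maps of `X₀(4)`,
`s ↦ 256(s² − 3)³/(s² − 4)`, and of `X₀(5)`, Klein–Fricke `t ↦ (t² + 10t + 5)³/t`).

Proof (explicit, kernel-checked algebra; derivation `work/level20/*.py` of the lead, attached as
evidence): the genus-`0` quotient `X₀(10)` of the fibre product by `s ↦ -s` has the rational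
parameter `β` with `t = (4β + 1)²(β − 1)/β`, `s² = u = 4(4β² + 1)(4β² − 2β − 1)²/(4β + 1)`
(a Belyĭ pair: `t` and `u − 4 = 256β⁵(β − 1)/(4β + 1)` are supported on the four cusps
`β ∈ {0, 1, -1/4, ∞}`), and conversely `β = N(u, t)/D(u, t)` with
`D = 4(u − 3)(t² + 4t − 1)(t² + 10t + 5)` — nonzero at rational points (`√3, √5 ∉ ℚ`; these are
the singular fibres `j = 0, 1728`) — and `N` of bidegree `(2, 4)`; the two displayed relations are
polynomial identities modulo the curve equation with explicit cofactors (`linear_combination`).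
Then `x = 4β`, `y = s(4β + 1)/(4β² − 2β − 1)` satisfy `y² = x³ + x² + 4x + 4` — the curve `20a1`,
a model of `X₀(20)` — whose rational points have `x ∈ {-1, 0, 4}` (`twentyA1_points`: the
`2`-isogeny to `y² = x³ + x² − x` and Kubert's determination of that curve's rational points, tree
theorem `X1TwoTen_points`); each of `β ∈ {-1/4, 0, 1}` contradicts `t ≠ 0` or the relations
(`β = 0, 1, -1/4` are cusps).

## References

* [Kenku1982] M. A. Kenku, J. Number Theory 15 (1982) 199–202, proof of Thm. 1 (level `20`).
* [Ligozat1975] G. Ligozat, *Courbes modulaires de genre 1*, Mém. SMF 43 (1975) (`X₀(20)`).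
* [Kubert1976] D. S. Kubert, Proc. London Math. Soc. (3) 33 (1976) 193–237, Ch. IV.
* [CremonaAlgorithms1997] J. E. Cremona, *Algorithms for Modular Elliptic Curves*, Table 1, `20A`.
-/



open Literature.NumberTheory.EllipticCurves

namespace Literature.NumberTheory.EllipticCurves.Kenku1982

/-! ### Small irrationalities -/

/-- A rational square is not a prime. [folklore]
[cite: Kenku1982, Thm. 1 and its proof (level 20)] -/
private theorem sq_ne_prime {p : ℕ} (hp : p.Prime) (q : ℚ) : q ^ 2 ≠ p := by
  intro h
  refine hp.irrational_sqrt ⟨|q|, ?_⟩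
  have hq : ((|q| : ℚ) : ℝ) ^ 2 = (p : ℝ) := by
    rw [Rat.cast_abs, sq_abs, ← Rat.cast_pow, h, Rat.cast_natCast]
  rw [← Real.sqrt_sq (by positivity : (0 : ℝ) ≤ ((|q| : ℚ) : ℝ)), hq]

/-- `3` is not a rational square. [folklore]
[cite: Kenku1982, Thm. 1 and its proof (level 20)] -/
theorem rat_sq_ne_three (q : ℚ) : q ^ 2 ≠ 3 := by exact_mod_cast sq_ne_prime Nat.prime_three q

/-- `5` is not a rational square. [folklore]
[cite: Kenku1982, Thm. 1 and its proof (level 20)] -/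
theorem rat_sq_ne_five (q : ℚ) : q ^ 2 ≠ 5 := by
  exact_mod_cast sq_ne_prime Nat.prime_five q

/-! ### The rational points of `20a1` -/

/-- **The rational points of `y² = x³ + x² + 4x + 4` have `x ∈ {-1, 0, 4}`** (the curve `20a1`,
a model of `X₀(20)`; via the `2`-isogeny to `y² = x³ + x² − x` and Kubert's determination of the
latter's rational points, tree theorem `X1TwoTen_points`). [cite: Kubert1976, Ch. IV]
[cite: SilvermanAEC2009, III.4 Example 4.5] -/
theorem twentyA1_points (x y : ℚ) (h : y ^ 2 = x ^ 3 + x ^ 2 + 4 * x + 4) :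
    x = -1 ∨ x = 0 ∨ x = 4 := by
  by_cases hx : x + 1 = 0
  · exact Or.inl (by linarith)
  -- `y² = x₁(x₁² - 2x₁ + 5)` with `x₁ = x + 1 ≠ 0`
  have h₁ : y ^ 2 = (x + 1) * ((x + 1) ^ 2 - 2 * (x + 1) + 5) := by linear_combination h
  -- the `2`-isogenous point `(x', y')` on `y'² = x'³ + x'² - x'`
  have h' : (y * ((x + 1) ^ 2 - 5) / (8 * (x + 1) ^ 2)) ^ 2 =
      (((x + 1) ^ 2 - 2 * (x + 1) + 5) / (4 * (x + 1))) ^ 3 +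
        (((x + 1) ^ 2 - 2 * (x + 1) + 5) / (4 * (x + 1))) ^ 2 -
        ((x + 1) ^ 2 - 2 * (x + 1) + 5) / (4 * (x + 1)) := by
    rw [div_pow, mul_pow, h₁]
    field_simp
    ring
  rcases X1TwoTen_points _ _ h' with h0 | h1 | hm1
  · -- `x' = 0`: `x₁² - 2x₁ + 5 = 0`, impossible
    rw [div_eq_zero_iff] at h0
    rcases h0 with h0 | h0
    · nlinarith [sq_nonneg x]
    · exact absurd (by linarith : x + 1 = 0) hx
  · -- `x' = 1`: `x₁² - 6x₁ + 5 = 0`, so `x₁ ∈ {1, 5}`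
    rw [div_eq_one_iff_eq (by positivity)] at h1
    have : x * (x - 4) = 0 := by linear_combination h1
    rcases mul_eq_zero.mp this with h | h
    · exact Or.inr (Or.inl h)
    · exact Or.inr (Or.inr (by linarith))
  · -- `x' = -1`: `x₁² + 2x₁ + 5 = 0`, impossible
    rw [div_eq_iff (by positivity), neg_one_mul] at hm1
    nlinarith [sq_nonneg (x + 2)]


/-! ### The Diophantine end -/

/-- Certificate 1 (the cubic relation `tβ = (4β + 1)²(β − 1)` for `β = N/D`, cleared of
denominators): a polynomial identity modulo the curve equation, cofactor of 26 terms. [folklore]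
[cite: Kenku1982, Thm. 1 and its proof (level 20)] -/
private theorem level20_cert_cubic {u t N D : ℚ}
    (hN : N =
    (16 : ℚ) * u ^ 2 * t ^ 2 + (48 : ℚ) * u ^ 2 * t + (1 : ℚ) * u * t ^ 4 + (16 : ℚ) * u * t ^ 3
    + (-30 : ℚ) * u * t ^ 2 + (-248 : ℚ) * u * t + (5 : ℚ) * u + (-4 : ℚ) * t ^ 4
    + (-68 : ℚ) * t ^ 3 + (-164 : ℚ) * t ^ 2 + (212 : ℚ) * t + (-40 : ℚ))
    (hD : D =
    (4 : ℚ) * u * t ^ 4 + (56 : ℚ) * u * t ^ 3 + (176 : ℚ) * u * t ^ 2 + (40 : ℚ) * u * t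
    + (-20 : ℚ) * u + (-12 : ℚ) * t ^ 4 + (-168 : ℚ) * t ^ 3 + (-528 : ℚ) * t ^ 2
    + (-120 : ℚ) * t + (60 : ℚ))
    (hP : 256 * t * (u - 3) ^ 3 = (u - 4) * (t ^ 2 + 10 * t + 5) ^ 3) :
    t * N * D ^ 2 = (4 * N + D) ^ 2 * (N - D) := by
  subst hN hD
  linear_combination (
    (-256 : ℚ) * u ^ 3 * t ^ 5 + (-2304 : ℚ) * u ^ 3 * t ^ 4 + (-6912 : ℚ) * u ^ 3 * t ^ 3 + (-6912 : ℚ) * u ^ 3 * t ^ 2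
    + (-16 : ℚ) * u ^ 2 * t ^ 7 + (-416 : ℚ) * u ^ 2 * t ^ 6 + (-1520 : ℚ) * u ^ 2 * t ^ 5 + (5696 : ℚ) * u ^ 2 * t ^ 4
    + (36368 : ℚ) * u ^ 2 * t ^ 3 + (45408 : ℚ) * u ^ 2 * t ^ 2 + (-3600 : ℚ) * u ^ 2 * t + (96 : ℚ) * u * t ^ 7
    + (2496 : ℚ) * u * t ^ 6 + (16032 : ℚ) * u * t ^ 5 + (28032 : ℚ) * u * t ^ 4 + (-31584 : ℚ) * u * t ^ 3
    + (-85824 : ℚ) * u * t ^ 2 + (21600 : ℚ) * u * t + (-144 : ℚ) * t ^ 7 + (-3728 : ℚ) * t ^ 6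
    + (-27024 : ℚ) * t ^ 5 + (-68112 : ℚ) * t ^ 4 + (-25136 : ℚ) * t ^ 3 + (60624 : ℚ) * t ^ 2
    + (-20400 : ℚ) * t + (2000 : ℚ)) * hP

/-- Certificate 2 (the reduced relation `u(4β + 1) = (t² + 10t + 5)β² + 12β + 3` for `β = N/D`,
cleared of denominators): a polynomial identity modulo the curve equation, cofactor of 10 terms.
[folklore]
[cite: Kenku1982, Thm. 1 and its proof (level 20)] -/
private theorem level20_cert_reduced {u t N D : ℚ}
    (hN : N =
    (16 : ℚ) * u ^ 2 * t ^ 2 + (48 : ℚ) * u ^ 2 * t + (1 : ℚ) * u * t ^ 4 + (16 : ℚ) * u * t ^ 3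
    + (-30 : ℚ) * u * t ^ 2 + (-248 : ℚ) * u * t + (5 : ℚ) * u + (-4 : ℚ) * t ^ 4
    + (-68 : ℚ) * t ^ 3 + (-164 : ℚ) * t ^ 2 + (212 : ℚ) * t + (-40 : ℚ))
    (hD : D =
    (4 : ℚ) * u * t ^ 4 + (56 : ℚ) * u * t ^ 3 + (176 : ℚ) * u * t ^ 2 + (40 : ℚ) * u * t
    + (-20 : ℚ) * u + (-12 : ℚ) * t ^ 4 + (-168 : ℚ) * t ^ 3 + (-528 : ℚ) * t ^ 2
    + (-120 : ℚ) * t + (60 : ℚ))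
    (hP : 256 * t * (u - 3) ^ 3 = (u - 4) * (t ^ 2 + 10 * t + 5) ^ 3) :
    u * (4 * N + D) * D = (t ^ 2 + 10 * t + 5) * N ^ 2 + 12 * N * D + 3 * D ^ 2 := by
  subst hN hD
  linear_combination (
    (1 : ℚ) * u * t ^ 4 + (12 : ℚ) * u * t ^ 3 + (22 : ℚ) * u * t ^ 2 + (-20 : ℚ) * u * t
    + (-15 : ℚ) * u + (-4 : ℚ) * t ^ 4 + (-56 : ℚ) * t ^ 3 + (-176 : ℚ) * t ^ 2
    + (-40 : ℚ) * t + (20 : ℚ)) * hP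

/-- The endgame on the curve `20a1`: rational `s, t, β` with `t ≠ 0`, `tβ = (4β + 1)²(β − 1)` and
`s²(4β + 1) = (t² + 10t + 5)β² + 12β + 3` do not exist — the two relations give
`s²(4β + 1) = 4(4β² + 1)(4β² − 2β − 1)²`, so `(4β, s(4β + 1)/(4β² − 2β − 1))` is a rational point
of `y² = x³ + x² + 4x + 4`, and `twentyA1_points` leaves `β ∈ {-1/4, 0, 1}`, the cusps, each
incompatible with the relations and `t ≠ 0`. [cite: Kubert1976, Ch. IV] -/
theorem level20_endgame {s t β : ℚ} (ht : t ≠ 0) (hT : t * β = (4 * β + 1) ^ 2 * (β - 1))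
    (hU : s ^ 2 * (4 * β + 1) = (t ^ 2 + 10 * t + 5) * β ^ 2 + 12 * β + 3) : False := by
  -- the cubic relation lifts the reduced relation to the curve equation
  have hC : 16 * β ^ 3 - 8 * β ^ 2 - (7 + t) * β - 1 = 0 := by linear_combination -hT
  have hU' : s ^ 2 * (4 * β + 1) = 4 * (4 * β ^ 2 + 1) * (4 * β ^ 2 - 2 * β - 1) ^ 2 := by
    linear_combination hU - (16 * β ^ 3 - 8 * β ^ 2 + β * t + 3 * β - 1) * hC
  have hq : 4 * β ^ 2 - 2 * β - 1 ≠ 0 := fun h ↦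
    rat_sq_ne_five (4 * β - 1) (by linear_combination 4 * h)
  have h41 : 4 * β + 1 ≠ 0 := by
    intro h
    rw [h, mul_zero] at hU'
    have h0 : (4 * β ^ 2 + 1) * (4 * β ^ 2 - 2 * β - 1) ^ 2 = 0 := by linear_combination -hU' / 4
    rcases mul_eq_zero.mp h0 with h1 | h2
    · exact absurd h1 (by positivity)
    · exact hq (pow_eq_zero_iff two_ne_zero |>.mp h2)
  have hE : (s * (4 * β + 1) / (4 * β ^ 2 - 2 * β - 1)) ^ 2 =
      (4 * β) ^ 3 + (4 * β) ^ 2 + 4 * (4 * β) + 4 := by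
    rw [div_pow, div_eq_iff (pow_ne_zero 2 hq), mul_pow]
    linear_combination (4 * β + 1) * hU'
  rcases twentyA1_points _ _ hE with h | h | h
  · exact h41 (by linear_combination h)
  · have hb : β = 0 := by linear_combination h / 4
    rw [hb] at hT
    norm_num at hT
  · have hb : β = 1 := by linear_combination h / 4
    rw [hb] at hT
    norm_num at hT
    exact ht hT

/-- **STUB `kenku_levelTwentyNoPoint`** (Kenku's level `20`, Diophantine end): no rational `s, t`
with `t ≠ 0`, `s² ≠ 4`, `256 t (s² − 3)³ = (s² − 4)(t² + 10t + 5)³` — i.e. the fibre product of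
the `j`-maps of `X₀(4)` and `X₀(5)` (`≃ X₀(20)`) has no rational point off the cusps. With
`u = s²`: `β = N(u,t)/D(u,t)`, `D = 4(u − 3)(t² + 4t − 1)(t² + 10t + 5) ≠ 0` (`√3, √5 ∉ ℚ`), the
two certificates, and `level20_endgame`. (`s² ≠ 4` is not even needed: `s = ±2` forces `t = 0`.)
[cite: Kenku1982, proof of Thm. 1, level 20] [cite: Ligozat1975] -/
theorem kenku_levelTwentyNoPoint :
    ∀ s t : ℚ, t ≠ 0 → s ^ 2 ≠ 4 →
      256 * t * (s ^ 2 - 3) ^ 3 = (s ^ 2 - 4) * (t ^ 2 + 10 * t + 5) ^ 3 → False := by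
  intro s t ht _ hP
  set u := s ^ 2 with hu
  -- the harmless denominator `D = 4(u − 3)(t² + 4t − 1)(t² + 10t + 5) ≠ 0`
  have h3 : u - 3 ≠ 0 := fun h ↦ rat_sq_ne_three s (by rw [← hu]; linear_combination h)
  have hq1 : t ^ 2 + 4 * t - 1 ≠ 0 := fun h ↦ rat_sq_ne_five (t + 2) (by linear_combination h)
  have hq2 : t ^ 2 + 10 * t + 5 ≠ 0 := fun h ↦
    rat_sq_ne_five ((t + 5) / 2) (by linear_combination h / 4)
  set N : ℚ :=
    (16 : ℚ) * u ^ 2 * t ^ 2 + (48 : ℚ) * u ^ 2 * t + (1 : ℚ) * u * t ^ 4 + (16 : ℚ) * u * t ^ 3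
    + (-30 : ℚ) * u * t ^ 2 + (-248 : ℚ) * u * t + (5 : ℚ) * u + (-4 : ℚ) * t ^ 4
    + (-68 : ℚ) * t ^ 3 + (-164 : ℚ) * t ^ 2 + (212 : ℚ) * t + (-40 : ℚ) with hN
  set D : ℚ :=
    (4 : ℚ) * u * t ^ 4 + (56 : ℚ) * u * t ^ 3 + (176 : ℚ) * u * t ^ 2 + (40 : ℚ) * u * t
    + (-20 : ℚ) * u + (-12 : ℚ) * t ^ 4 + (-168 : ℚ) * t ^ 3 + (-528 : ℚ) * t ^ 2
    + (-120 : ℚ) * t + (60 : ℚ) with hD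
  have hD0 : D ≠ 0 := by
    have e : D = 4 * (u - 3) * (t ^ 2 + 4 * t - 1) * (t ^ 2 + 10 * t + 5) := by rw [hD]; ring
    rw [e]
    exact mul_ne_zero (mul_ne_zero (mul_ne_zero four_ne_zero h3) hq1) hq2
  have hT := level20_cert_cubic hN hD hP
  have hU := level20_cert_reduced hN hD hP
  clear_value N D
  -- pass to `β = N/D`
  obtain ⟨β, rfl⟩ : ∃ β, N = β * D := ⟨N / D, by field_simp⟩
  have hT' : t * β = (4 * β + 1) ^ 2 * (β - 1) := by
    apply mul_left_cancel₀ (pow_ne_zero 3 hD0)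
    linear_combination hT
  have hU' : u * (4 * β + 1) = (t ^ 2 + 10 * t + 5) * β ^ 2 + 12 * β + 3 := by
    apply mul_left_cancel₀ (pow_ne_zero 2 hD0)
    linear_combination hU
  exact level20_endgame ht hT' (hu ▸ hU')

end Literature.NumberTheory.EllipticCurves.Kenku1982

/-!
# Crux `MazurKenkuBound` (stmt-ABC-15125), line `radius-lite` — Kenku's level `20` WITHOUT
# modular curves: no cyclic `ℚ`-isogeny of degree `20` (reduction to the fibre product
# `X₀(4) ×_{X(1)} X₀(5)` + the landed Diophantine end)

A cyclic `20`-isogeny `ψ` out of `V` has a cyclic sub-isogeny of degree `4 = 2²`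
(`Isogeny.exists_isCyclic_degree_eq_of_dvd`), whose kernel is put in two-torsion normal form
`y² = x³ + ax² + bx` on a `ℚ`-isomorphic model with the SAME `j` (the `j`-preserving form of the
landed `exists_twoTorsionNF_of_isCyclic_isogeny`, p141542; `variableChange_j`); the vertex
criterion (`twoVertex_exists_sq`, p141021, `k = 2`) gives `b = d²`, so
`j(V) · d⁴(a² − 4d²) = 256 (a² − 3d²)³` (`Δ = 16b²(a² − 4b)`, `c₄ = 16(a² − 3b)`), i.e.
`j = 256(s² − 3)³/(s² − 4)` with `s = a/d` — the coordinate `s` of `X₀(4)`; and the degree-`5`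
part gives Klein–Fricke `j = (t² + 10t + 5)³/t`, `t ≠ 0` (`exists_j_eq_klein_five_of_five_dvd_degree`).
Hence a rational solution of `256 t (s² − 3)³ = (s² − 4)(t² + 10t + 5)³` with `t ≠ 0`, `s² ≠ 4`:
an affine non-cuspidal rational point of the (genus-one) fibre product `X₀(4) ×_{X(1)} X₀(5) ≃ X₀(20)`.
Step 2, the Diophantine end (no such point: Belyĭ inversion of `X₀(10)`, the curve `20a1`, Kubert's
determination of `X₁(2,10)(ℚ)` — tree `X1TwoTen_points`), is the landed
`…LevelTwentyDiophantine.lean` (`kenku_levelTwentyNoPoint`); the assembly `kenku_levelTwenty` and the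
discharge `isogeny_isCyclic_degree_ne_twenty_holds` of the Literature named fact
`isogeny_isCyclic_degree_ne_twenty` (wanted by crux stmt-ABC-11340) close the file.

## References

* [Kenku1982] M. A. Kenku, J. Number Theory 15 (1982) 199–202, proof of Thm. 1 (level `20`).
* [Ligozat1975] G. Ligozat, *Courbes modulaires de genre 1*, Mém. SMF 43 (1975) (`X₀(20)`).
* [SilvermanAEC2009] J. H. Silverman, *The Arithmetic of Elliptic Curves*, 2nd ed., III.1
  (`j = c₄³/Δ`), III.4 Example 4.5, X.4.9.
-/



open scoped Classical
open WeierstrassCurve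
open Literature.NumberTheory.EllipticCurves

namespace Literature.NumberTheory.EllipticCurves.Kenku1982

universe u

/-! ### Two facts on finite cyclic groups -/

/-- A finite cyclic subgroup has at most one element of order `2`: the number of elements of
order `d` in a cyclic group of order `n`, `d ∣ n`, is `φ(d)`, and `φ(2) = 1`. [folklore]
[cite: Kenku1982, Thm. 1 and its proof (level 20)] -/
private theorem eq_of_two_nsmul_eq_zero_of_isAddCyclic {G : Type*} [AddCommGroup G]
    (H : AddSubgroup G) [IsAddCyclic H] [Finite H] {P Q : G} (hP : P ∈ H) (hQ : Q ∈ H)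
    (h2P : 2 • P = 0) (hP0 : P ≠ 0) (h2Q : 2 • Q = 0) (hQ0 : Q ≠ 0) : P = Q := by
  haveI := Fintype.ofFinite H
  have hP2 : addOrderOf (⟨P, hP⟩ : H) = 2 :=
    (AddSubgroup.addOrderOf_mk P hP).trans (addOrderOf_eq_prime h2P hP0)
  have hQ2 : addOrderOf (⟨Q, hQ⟩ : H) = 2 :=
    (AddSubgroup.addOrderOf_mk Q hQ).trans (addOrderOf_eq_prime h2Q hQ0)
  have hdvd : 2 ∣ Fintype.card H := hP2 ▸ addOrderOf_dvd_card
  obtain ⟨a, ha⟩ := Finset.card_eq_one.mp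
    ((IsAddCyclic.card_addOrderOf_eq_totient hdvd).trans Nat.totient_two)
  have hPa : (⟨P, hP⟩ : H) ∈ ({a} : Finset H) := by
    rw [← ha]
    exact Finset.mem_filter.mpr ⟨Finset.mem_univ _, hP2⟩
  have hQa : (⟨Q, hQ⟩ : H) ∈ ({a} : Finset H) := by
    rw [← ha]
    exact Finset.mem_filter.mpr ⟨Finset.mem_univ _, hQ2⟩
  rw [Finset.mem_singleton] at hPa hQa
  exact congrArg Subtype.val (hPa.trans hQa.symm)

/-- A cyclic subgroup of order `2ᵏ`, `k ≥ 1`, contains an element of order `2`, namely `2ᵏ⁻¹ g`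
for a generator `g`. [folklore]
[cite: Kenku1982, Thm. 1 and its proof (level 20)] -/
private theorem exists_two_nsmul_eq_zero_of_card_eq {G : Type*} [AddCommGroup G]
    (H : AddSubgroup G) [IsAddCyclic H] {k : ℕ} (hk : 1 ≤ k) (hcard : Nat.card H = 2 ^ k) :
    ∃ T ∈ H, 2 • T = 0 ∧ T ≠ 0 := by
  obtain ⟨g, hg⟩ := IsAddCyclic.exists_ofOrder_eq_natCard (α := H)
  rw [hcard, ← AddSubgroup.addOrderOf_coe] at hg
  refine ⟨2 ^ (k - 1) • (g : G), H.nsmul_mem g.2 _, ?_, ?_⟩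
  · rw [smul_smul, ← pow_succ', show k - 1 + 1 = k by omega, ← hg]
    exact addOrderOf_nsmul_eq_zero _
  · intro h0
    have hdvd := addOrderOf_dvd_of_nsmul_eq_zero h0
    rw [hg, Nat.pow_dvd_pow_iff_le_right Nat.one_lt_two] at hdvd
    omega

/-! ### The `j`-preserving two-torsion normal form -/

/-- Bookkeeping: a curve `V` in two-torsion normal form *is* the literal equation
`⟨0, a₂(V), 0, a₄(V), 0⟩` (same `j`), so data on `V` are data on that equation. [folklore]
[cite: Kenku1982, Thm. 1 and its proof (level 20)] -/
private theorem exists_literal_j_of_isTwoTorsionNF {K : Type u} [Field K] (V : WeierstrassCurve K)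
    [hV : V.IsTwoTorsionNF] [hE : V.IsElliptic] (C : AddSubgroup V.geomPoints) (k : ℕ)
    (hst : ∀ σ : Field.absoluteGaloisGroup K, ∀ P ∈ C, σ • P ∈ C) (hcyc : IsAddCyclic C)
    (hcard : Nat.card C = 2 ^ k)
    (h2 : ∀ P ∈ C, 2 • P = 0 → P ≠ 0 → P = V.geomTwoTorsionPoint) :
    ∃ (a b : K) (_ : (⟨0, a, 0, b, 0⟩ : WeierstrassCurve K).IsElliptic)
      (C' : AddSubgroup (⟨0, a, 0, b, 0⟩ : WeierstrassCurve K).geomPoints),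
      (⟨0, a, 0, b, 0⟩ : WeierstrassCurve K).j = V.j ∧
      (∀ σ : Field.absoluteGaloisGroup K, ∀ P ∈ C', σ • P ∈ C') ∧ IsAddCyclic C' ∧
        Nat.card C' = 2 ^ k ∧
        ∀ P ∈ C', 2 • P = 0 → P ≠ 0 →
          P = (⟨0, a, 0, b, 0⟩ : WeierstrassCurve K).geomTwoTorsionPoint := by
  obtain ⟨v₁, v₂, v₃, v₄, v₆⟩ := V
  have h₁ : v₁ = 0 := hV.a₁
  have h₃ : v₃ = 0 := hV.a₃
  have h₆ : v₆ = 0 := hV.a₆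
  subst h₁ h₃ h₆
  exact ⟨v₂, v₄, hE, C, rfl, hst, hcyc, hcard, h2⟩

/-- **Two-torsion normal form of a cyclic `2`-power isogeny kernel, with the same `j`.** The
landed `exists_twoTorsionNF_of_isCyclic_isogeny` (p141542) records the normal form
`y² = x³ + ax² + bx` up to `K`-isomorphism only; here the model is remembered to be a change of
variables of `E` (`variableChange_j`), so `j` is unchanged. Proof otherwise verbatim.
[cite: SilvermanAEC2009, III.4 Example 4.5, X.4.9] -/
theorem exists_twoTorsionNF_j_eq_of_isCyclic_isogeny {K : Type u} [Field K] [PerfectField K]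
    (htwo : (2 : K) ≠ 0) (W W' : WeierstrassCurve K) [W.IsElliptic] (ψ : Isogeny W W') {k : ℕ}
    (hk : 1 ≤ k) (hcyc : ψ.IsCyclic) (hdeg : ψ.degree = 2 ^ k) :
    ∃ (a b : K) (_ : (⟨0, a, 0, b, 0⟩ : WeierstrassCurve K).IsElliptic)
      (C : AddSubgroup (⟨0, a, 0, b, 0⟩ : WeierstrassCurve K).geomPoints),
      (⟨0, a, 0, b, 0⟩ : WeierstrassCurve K).j = W.j ∧
      (∀ σ : Field.absoluteGaloisGroup K, ∀ P ∈ C, σ • P ∈ C) ∧ IsAddCyclic C ∧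
        Nat.card C = 2 ^ k ∧
        ∀ P ∈ C, 2 • P = 0 → P ≠ 0 →
          P = (⟨0, a, 0, b, 0⟩ : WeierstrassCurve K).geomTwoTorsionPoint := by
  -- the kernel `C₀ = E[ψ]`: cyclic of order `2ᵏ`, `Γ_K`-stable
  haveI : IsAddCyclic ψ.toAddMonoidHom.ker := hcyc
  haveI : Finite ψ.toAddMonoidHom.ker := ψ.finite_ker'
  have hcard₀ : Nat.card ψ.toAddMonoidHom.ker = 2 ^ k := hdeg
  have hst₀ : ∀ σ : Field.absoluteGaloisGroup K, ∀ P ∈ ψ.toAddMonoidHom.ker,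
      σ • P ∈ ψ.toAddMonoidHom.ker := fun σ P hP ↦ by
    rw [AddMonoidHom.mem_ker, Isogeny.coe_toAddMonoidHom] at hP ⊢
    rw [ψ.map_smul, hP, smul_zero]
  -- its unique element `T₀` of order `2`, which is `Γ_K`-fixed
  obtain ⟨T₀, hT₀C, h2T₀, hT₀0⟩ :=
    exists_two_nsmul_eq_zero_of_card_eq ψ.toAddMonoidHom.ker hk hcard₀
  have huniq : ∀ P ∈ ψ.toAddMonoidHom.ker, 2 • P = 0 → P ≠ 0 → P = T₀ := fun P hP h2P hP0 ↦
    eq_of_two_nsmul_eq_zero_of_isAddCyclic ψ.toAddMonoidHom.ker hP hT₀C h2P hP0 h2T₀ hT₀0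
  have hfix : ∀ σ : Field.absoluteGaloisGroup K, σ • T₀ = T₀ := fun σ ↦
    huniq _ (hst₀ σ _ hT₀C) (by rw [smul_comm, h2T₀, smul_zero])
      ((smul_ne_zero_iff_ne σ).mpr hT₀0)
  -- hence `K`-rational: `T₀ = T = (x₀, y₀)` with `2T = O`, `y₀ = -y₀ - a₁x₀ - a₃`
  obtain ⟨T, hT⟩ := exists_toGeomPoints_eq_of_forall_smul_eq W hfix
  subst hT
  rcases T with _ | ⟨x₀, y₀, h₀⟩
  · exact absurd (map_zero _) hT₀0
  have h2T : 2 • (Affine.Point.some x₀ y₀ h₀ : W.toAffine.Point) = 0 :=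
    W.toGeomPoints_injective (by rw [map_nsmul, h2T₀, map_zero])
  have hy₀ : y₀ = W.toAffine.negY x₀ y₀ := by
    by_contra hy
    apply Affine.Point.some_ne_zero (Affine.nonsingular_add h₀ h₀ fun hxy ↦ hy hxy.right)
    rw [← Affine.Point.add_self_of_Y_ne (h₁ := h₀) hy, ← two_nsmul, h2T]
  -- the normal form `V = Cv • W` and the isomorphism `ι : W ≅ V`, with `ι T₀ = (0, 0)`
  set Cv : VariableChange K := ⟨1, x₀, -W.a₁ / 2, y₀⟩ with hCv
  haveI : (Cv • W).IsTwoTorsionNF := isTwoTorsionNF_smul_of_two_nsmul_eq_zero htwo h₀ hy₀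
  have hTT : VariableChange.toIsogeny W Cv (W.toGeomPoints (Affine.Point.some x₀ y₀ h₀)) =
      (Cv • W).geomTwoTorsionPoint := by
    obtain ⟨hns, e₀⟩ : ∃ hns, W.toGeomPoints (Affine.Point.some x₀ y₀ h₀) =
        Affine.Point.some (algebraMap K (AlgebraicClosure K) x₀)
          (algebraMap K (AlgebraicClosure K) y₀) hns := ⟨_, rfl⟩
    rw [e₀, VariableChange.toIsogeny_some]
    have hx : (Cv.map (algebraMap K (AlgebraicClosure K))).toX
        (algebraMap K (AlgebraicClosure K) x₀) = 0 := by
      simp [hCv, VariableChange.toX_def, VariableChange.map]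
    have hy : (Cv.map (algebraMap K (AlgebraicClosure K))).toY
        (algebraMap K (AlgebraicClosure K) x₀) (algebraMap K (AlgebraicClosure K) y₀) = 0 := by
      simp [hCv, VariableChange.toY_def, VariableChange.map]
    obtain ⟨h', e'⟩ := UnivEC.some_eq_some_of_eq hx hy
      ((VariableChange.baseChange_smul_eq W Cv (AlgebraicClosure K)) ▸
        (VariableChange.nonsingular_iff (W.baseChange (AlgebraicClosure K))
          (Cv.map (algebraMap K (AlgebraicClosure K))) _ _).mpr hns)
    exact e'
  -- transport of the kernel along `ι`
  have hinj : Function.Injective (VariableChange.toIsogeny W Cv).toAddMonoidHom :=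
    VariableChange.toIsogeny_injective W Cv
  have hjW : (Cv • W).j = W.j := by rw [variableChange_j]
  rw [← hjW]
  refine exists_literal_j_of_isTwoTorsionNF (Cv • W)
    (ψ.toAddMonoidHom.ker.map (VariableChange.toIsogeny W Cv).toAddMonoidHom) k
    ?_ ?_ ?_ ?_
  · rintro σ P ⟨Q, hQ, rfl⟩
    exact AddSubgroup.mem_map.mpr ⟨σ • Q, hst₀ σ Q hQ, (VariableChange.toIsogeny W Cv).map_smul σ Q⟩
  · exact isAddCyclic_of_surjective _ (ψ.toAddMonoidHom.ker.equivMapOfInjective _ hinj).surjective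
  · exact (Nat.card_congr (ψ.toAddMonoidHom.ker.equivMapOfInjective _ hinj).toEquiv).symm.trans
      hcard₀
  · rintro P ⟨Q, hQ, rfl⟩ h2P hP0
    have h2Q : 2 • Q = 0 := hinj (by rw [map_nsmul, map_zero]; exact h2P)
    have hQ0 : Q ≠ 0 := by
      rintro rfl
      exact hP0 (map_zero _)
    rw [huniq Q hQ h2Q hQ0]
    exact hTT

/-! ### The reduction of level `20` to the fibre product `X₀(4) ×_{X(1)} X₀(5)` -/

/-- `j` of `y² = x³ + ax² + d²x` (elliptic): `d ≠ 0`, `a² ≠ 4d²` and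
`j · d⁴(a² − 4d²) = 256 (a² − 3d²)³` (`c₄ = 16(a² − 3d²)`, `Δ = 16d⁴(a² − 4d²)`, `j = c₄³/Δ`).
[cite: SilvermanAEC2009, III.1 (j = c₄³/Δ)] -/
theorem j_twoTorsionNF_sq (a d : ℚ) [hE : (⟨0, a, 0, d ^ 2, 0⟩ : WeierstrassCurve ℚ).IsElliptic] :
    d ≠ 0 ∧ a ^ 2 ≠ 4 * d ^ 2 ∧
      (⟨0, a, 0, d ^ 2, 0⟩ : WeierstrassCurve ℚ).j * (d ^ 4 * (a ^ 2 - 4 * d ^ 2)) =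
        256 * (a ^ 2 - 3 * d ^ 2) ^ 3 := by
  set V : WeierstrassCurve ℚ := ⟨0, a, 0, d ^ 2, 0⟩ with hV
  have h4 := WeierstrassCurve.a₄_ne_zero V
  have h2 := WeierstrassCurve.a₂_sq_sub_ne_zero V
  simp only [hV] at h4 h2
  have hd : d ≠ 0 := fun h ↦ h4 (by rw [h]; ring)
  have ha : a ^ 2 ≠ 4 * d ^ 2 := fun h ↦ h2 (by rw [h]; ring)
  refine ⟨hd, ha, ?_⟩
  have hΔ : V.Δ = 16 * (d ^ 2) ^ 2 * (a ^ 2 - 4 * d ^ 2) := Δ_of_isTwoTorsionNF V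
  have hc₄ : V.c₄ = 16 * (a ^ 2 - 3 * d ^ 2) := by
    simp only [hV, WeierstrassCurve.c₄, WeierstrassCurve.b₂, WeierstrassCurve.b₄]
    ring
  have hΔ0 : V.Δ ≠ 0 := by
    rw [← V.coe_Δ']
    exact V.Δ'.ne_zero
  have hj : V.j = V.c₄ ^ 3 / V.Δ := by
    rw [WeierstrassCurve.j, Units.val_inv_eq_inv_val, WeierstrassCurve.coe_Δ', div_eq_inv_mul]
  have hΔ0' : 16 * (d ^ 2) ^ 2 * (a ^ 2 - 4 * d ^ 2) ≠ 0 := hΔ ▸ hΔ0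
  rw [hj, hc₄, hΔ, div_mul_eq_mul_div, div_eq_iff hΔ0']
  ring

/-- **Kenku's level `20`, step 1.** A cyclic `ℚ`-isogeny of degree `20` out of an elliptic curve
over `ℚ` yields rational `s, t` with `t ≠ 0`, `s² ≠ 4` and
`256 t (s² − 3)³ = (s² − 4)(t² + 10t + 5)³` — an affine rational point, off the cusps, of the
fibre product of the `j`-maps of `X₀(4)` (`s ↦ 256(s² − 3)³/(s² − 4)`, from the `j`-preserving
two-torsion normal form of the cyclic degree-`4` part and the vertex criterion) and of `X₀(5)`
(Klein–Fricke `t ↦ (t² + 10t + 5)³/t`). [cite: Kenku1982, proof of Thm. 1, level 20]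
[cite: SilvermanAEC2009, III.4 Example 4.5] -/
theorem exists_fibreProduct_point_of_isCyclic_degree_twenty {V V' : WeierstrassCurve ℚ}
    [V.IsElliptic] [V'.IsElliptic] (ψ : Isogeny V V') (hψ : ψ.IsCyclic) (hdeg : ψ.degree = 20) :
    ∃ s t : ℚ, t ≠ 0 ∧ s ^ 2 ≠ 4 ∧
      256 * t * (s ^ 2 - 3) ^ 3 = (s ^ 2 - 4) * (t ^ 2 + 10 * t + 5) ^ 3 := by
  -- the cyclic degree-`4` part, in `j`-preserving two-torsion normal form, with `b = d²`
  obtain ⟨V₂, hV₂, ψ₄, hψ₄c, hψ₄d, -⟩ :=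
    ψ.exists_isCyclic_degree_eq_of_dvd hψ (d := 4) (hdeg ▸ (by norm_num : (4 : ℕ) ∣ 20))
  haveI := hV₂
  obtain ⟨a, b, hE, C, hj, hst, hcyc, hcard, h2⟩ :=
    exists_twoTorsionNF_j_eq_of_isCyclic_isogeny two_ne_zero V V₂ ψ₄ (k := 2) (by norm_num)
      hψ₄c (by rw [hψ₄d]; norm_num)
  haveI := hE
  obtain ⟨d, rfl⟩ := twoVertex_exists_sq (⟨0, a, 0, b, 0⟩ : WeierstrassCurve ℚ) C (k := 2) le_rfl
    hst hcyc hcard h2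
  obtain ⟨hd, ha, hjE⟩ := j_twoTorsionNF_sq a d
  -- the degree-`5` part: Klein–Fricke
  obtain ⟨t, ht, hjt⟩ :=
    ψ.exists_j_eq_klein_five_of_five_dvd_degree hψ (hdeg ▸ (by norm_num : (5 : ℕ) ∣ 20))
  have hsq : d ^ 2 * (a / d) ^ 2 = a ^ 2 := by field_simp
  refine ⟨a / d, t, ht, ?_, ?_⟩
  · intro h
    exact ha (by rw [← hsq, h]; ring)
  · rw [hj, hjt] at hjE
    have key : (t ^ 2 + 10 * t + 5) ^ 3 * (d ^ 4 * (a ^ 2 - 4 * d ^ 2)) =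
        256 * (a ^ 2 - 3 * d ^ 2) ^ 3 * t := by
      rw [div_mul_eq_mul_div, div_eq_iff ht] at hjE
      exact hjE
    have hd6 : d ^ 6 ≠ 0 := pow_ne_zero 6 hd
    apply mul_left_cancel₀ hd6
    calc d ^ 6 * (256 * t * ((a / d) ^ 2 - 3) ^ 3)
        = 256 * t * (d ^ 2 * (a / d) ^ 2 - 3 * d ^ 2) ^ 3 := by ring
      _ = 256 * t * (a ^ 2 - 3 * d ^ 2) ^ 3 := by rw [hsq]
      _ = d ^ 4 * (a ^ 2 - 4 * d ^ 2) * (t ^ 2 + 10 * t + 5) ^ 3 := by linear_combination -key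
      _ = d ^ 4 * (d ^ 2 * (a / d) ^ 2 - 4 * d ^ 2) * (t ^ 2 + 10 * t + 5) ^ 3 := by rw [hsq]
      _ = d ^ 6 * (((a / d) ^ 2 - 4) * (t ^ 2 + 10 * t + 5) ^ 3) := by ring

/-! ### Level `20` -/

/-- **STUB `kenku_levelTwenty`: no cyclic `ℚ`-isogeny of degree `20`** (Kenku's level `20`,
`Y₀(20)(ℚ) = ∅` — Ligozat 1975 / Kenku 1982 — WITHOUT modular curves): the reduction
`exists_fibreProduct_point_of_isCyclic_degree_twenty` and the Diophantine end
`kenku_levelTwentyNoPoint`. [cite: Kenku1982, proof of Thm. 1, level 20] [cite: Ligozat1975] -/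
theorem kenku_levelTwenty :
    ∀ (V V' : WeierstrassCurve ℚ) [V.IsElliptic] [V'.IsElliptic] (ψ : Isogeny V V'),
      ψ.IsCyclic → ψ.degree ≠ 20 := by
  intro V V' _ _ ψ hψ h20
  obtain ⟨s, t, ht, hs, hP⟩ := exists_fibreProduct_point_of_isCyclic_degree_twenty ψ hψ h20
  exact kenku_levelTwentyNoPoint s t ht hs hP

end Literature.NumberTheory.EllipticCurves.Kenku1982

namespace Literature.NumberTheory.EllipticCurves

open Kenku1982

/-- **The Literature named fact `isogeny_isCyclic_degree_ne_twenty` HOLDS** (Kenku 1982, level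
`20`; the only modular-curve input `h20` of the line `Sketch` of crux stmt-ABC-11340,
`freyModularity_of_CDT721_CDT722_switch_degreeNeTwenty`). Proved Summits-side because its
two-chain inputs (`kenku_twoVertex`, the `j`-preserving normal form) live under `Summits/…/Theorems`.
[cite: Kenku1982, Thm. 1] -/
theorem isogeny_isCyclic_degree_ne_twenty_holds :
    Literature.NumberTheory.EllipticCurves.isogeny_isCyclic_degree_ne_twenty :=
  fun W₁ W₂ _ _ φ hφ ↦ kenku_levelTwenty W₁ W₂ φ hφ

end Literature.NumberTheory.EllipticCurves

end
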